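import Summits.Ventures.MM22.Rank333.GF2ProfileRowsSub
import HarnessLib

/-!
# Cell pub-mm22 — a kernel checker for FIXED-PROFILE REALIZABILITY refutations (the E3 phantom leaves)

Cell `pub-mm22` (MatrixMultiplication venture; HOME `run/shared/lean/pub/pub-mm22/`; seat engine-1 g9), topic
`Summits/Ventures/MM22` (generic in the format `⟨l,m,n⟩` and the constraint list `K`).
HONEST FRAMING: checker PLUMBING with its soundness theorem — not a bound and not a result.  It is the kernel form
of the cell's «realizability» step (REALIZE-NOTE §2 / REALIZE-CERT v1, p2; e1realize, engine-1; referee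
REF-REALIZE-CERT): a computation `β` of `ψ_K = XY|_{S_K × 𝔽₂^{m×n}}` whose first forms are represented by a given
multiset of patterns (a «profile») constrains the OUTPUT vectors `w_i ∈ 𝔽₂^{l×n}` linearly, and for some profiles
no outputs exist.  The facts used, for points `x_1, …, x_ℓ ∈ S_K`:

* SLICES: `(x_s E_b)_{s} = ∑_i g_i(E_b) · (f_i(x_s) w_i)_s` for every input basis matrix `E_b` (the defining
  identity of `β` at `(x_s, E_b)`), so `W := span_b (x_s E_b)_s ≤ span_i v_i`, `v_i := (f_i(x_s))_s ⊗ w_i`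
  (de Groote 1978 Prop. 1.2 is the case `ℓ = dim S_K`);
* TIGHTNESS: if the assigned products span `A ∋ v_i` (`i` assigned), the unassigned ones with `(f_i(x_s))_s ≠ 0`
  number `u`, and `W + A` contains `≥ dim A + u` independent vectors, then `W + A = A + span(unassigned v_i)` and
  every unassigned `v_i` lies in `W + A` and NOT in `A` (in particular `w_i ≠ 0`) — pure dimension counting;
* OUTPUT SYMMETRY: `(f_i, g_i(· C⁻¹), w_i C)` computes `XY` again for `C ∈ GL_n(𝔽₂)` (used once, at the root).

`RNode.check` replays a refutation tree (kinds `D` = a product's output has no admissible value, `B` = branch on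
the admissible values — both via a duality certificate for the linearly admissible values, no enumeration of `𝔽₂^{l n}` —, `S` = root branch up to output symmetry, `V` = a violated count) on bit-level data, and
`RealizeSound.notRealizable_of_check` (three files down) turns `check = true` into «no computation of `ψ_K` is represented by a profile that is a
permutation of `ph`».  Consumers: `Psi10Phantoms.lean` (the seven surviving 18-term profiles of `ψ_[10] =
⟨2,3,4⟩/(X₀₁+X₁₀)`, cell E3 step [δ]).  Conventions = `GF2MatrixBits` (`x` bit `j + m i`, output bit `k + n i`).
-/

namespace Summit.Ventures.MM22.GF2Cert.Realize

open Summit.MatrixMultiplication.OmegaCensus.GF2RankLB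
open Summit.Ventures.MM22.GF2Cert.Profile
open Literature.Computability.AlgebraicComplexity
open Module Matrix

/-! ## Bit-level primitives -/

/-- `ℓ`-bit vector of the values `⟨κ, x_s⟩` of the pattern `κ` at the points `xs` (`N = l m` bits). -/
def lval (N : ℕ) (xs : List ℕ) (κ : ℕ) : ℕ := maskOf (fun s => bdot N κ (xs.getD s 0)) xs.length

/-- Kronecker product of an `ℓ`-bit vector `lp` with a `w`-bit block `c`: block `s` is `c` if bit `s` of `lp`. -/
def kronBits (w ℓ lp c : ℕ) : ℕ := maskOf (fun t => lp.testBit (t / w) && c.testBit (t % w)) (ℓ * w)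

/-- `xor` of the sublist selected by the bits of `mask`. -/
def xorSel : List ℕ → ℕ → ℕ
  | [], _ => 0
  | a :: L, mask => (if mask.testBit 0 then a else 0) ^^^ xorSel L (mask / 2)

/-- Echelon test: every later element is below `2 ^ (log₂ a)` (so leading bits strictly decrease). -/
def echelonB : List ℕ → Bool
  | [] => true
  | a :: L => decide (0 < a) && L.all (fun b => decide (b < 2 ^ Nat.log2 a)) && echelonB L

/-- Fold an `ℓ w`-bit vector `y` along `lp`: `xor` of the `w`-bit blocks `s` of `y` with bit `s` of `lp` set
(so that `⟨y, lp ⊗ c⟩ = ⟨foldBits lp y, c⟩`). -/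
def foldBits (w ℓ lp y : ℕ) : ℕ := maskOf (fun k => bxor (fun s => lp.testBit s && y.testBit (k + w * s)) ℓ) w

/-- Duality witnesses: `⟨E_j, X_i⟩ = [i = j]`. -/
def deltaB (w : ℕ) (E X : List ℕ) : Bool :=
  (List.range E.length).all fun j => (List.range X.length).all fun i =>
    bdot w (E.getD j 0) (X.getD i 0) == decide (i = j)

/-- One tight-functional certificate: points `xs`, the assigned classes `gA` whose vectors generate `A`,
independent vectors `R` of `W + A` given by selection masks `Rsel` over `uList ++ assignedVecs`, and
annihilators `Y` of `uList ++ assignedVecs`. -/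
structure LCert where
  /-- points of `S_K` (patterns, `l m` bits) -/
  xs : List ℕ
  /-- assigned classes generating `A` (a sublist of the assignment's classes) -/
  gA : List ℕ
  /-- selection masks: `R_j = xorSel (uList ++ assignedVecs) (Rsel j)` -/
  Rsel : List ℕ
  /-- annihilating vectors of `uList ++ assignedVecs` -/
  Y : List ℕ

/-- A node certificate: tight functionals `Ls` (all meeting the node's class), and a duality certificate for
the kernel of the folded annihilator rows on `𝔽₂^{l n}` — `Esel` selects `|E|` combinations of rows with dual
vectors `X` (`⟨E_j, X_i⟩ = δ_ij`), and `Z` is an echelon basis of the kernel (`|E| + |Z| = l n`). -/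
structure NodeCert where
  /-- tight functionals -/
  Ls : List LCert
  /-- selection masks over the folded rows -/
  Esel : List ℕ
  /-- dual witnesses -/
  X : List ℕ
  /-- kernel basis (output values not excluded linearly are the subset-`xor`s of `Z`) -/
  Z : List ℕ

/-- Refutation trees. Children of `B`/`S` are indexed by the output value `c < 2^(l n)` (slot `0` unused). -/
inductive RNode (W : ℕ) : Type
  /-- no admissible output value for (the product of) class `g` -/
  | D (g : ℕ) (nc : NodeCert) : RNode W
  /-- a violated count at `L` -/
  | V (L : LCert) : RNode W
  /-- branch on the output value of class `g` -/
  | B (g : ℕ) (nc : NodeCert) (kids : Fin W → RNode W) : RNode W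
  /-- root branch on class `g` up to right multiplication by `GL_n(𝔽₂)`: `wit c = (C, C⁻¹)` with
  `c C ∈ reps`, one subtree per representative -/
  | S (g : ℕ) (wit : Fin W → ℕ × ℕ) (reps : List ℕ) (kids : Fin W → RNode W) : RNode W
  /-- an always-failing node (default child) -/
  | fail : RNode W

/-- The slice vectors `u_b`, `b < m n` (= `flatRow1`). -/
def uList (l m n : ℕ) (xs : List ℕ) : List ℕ := (List.range (m * n)).map (flatRow1 l m n xs)

/-- The vectors of the assigned classes meeting `xs`. -/
def aVecs (l m n : ℕ) (xs : List ℕ) (σ : List (ℕ × ℕ)) : List ℕ :=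
  (σ.filter fun gc => lval (l * m) xs gc.1 != 0).map
    fun gc => kronBits (l * n) xs.length (lval (l * m) xs gc.1) gc.2

/-- The value assigned to class `g` (`0` if unassigned). -/
def valOf (σ : List (ℕ × ℕ)) (g : ℕ) : ℕ := match σ.find? (fun gc => gc.1 == g) with
  | some gc => gc.2 | none => 0

/-- Is class `g` assigned? -/
def assigned (σ : List (ℕ × ℕ)) (g : ℕ) : Bool := σ.any fun gc => gc.1 == g

/-- Number of UNASSIGNED profile entries (with multiplicity) meeting `xs`. -/
def unassignedCount (l m : ℕ) (ph : List ℕ) (xs : List ℕ) (σ : List (ℕ × ℕ)) : ℕ :=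
  (ph.filter fun g => lval (l * m) xs g != 0 && !assigned σ g).length

/-- The vectors generating `A` (classes `gA` at their assigned values). -/
def LCert.gAv (l m n : ℕ) (σ : List (ℕ × ℕ)) (L : LCert) : List ℕ :=
  L.gA.map fun g => kronBits (l * n) L.xs.length (lval (l * m) L.xs g) (valOf σ g)

/-- The independent vectors `R` of `W + A`. -/
def LCert.R (l m n : ℕ) (σ : List (ℕ × ℕ)) (L : LCert) : List ℕ :=
  L.Rsel.map (xorSel (uList l m n L.xs ++ aVecs l m n L.xs σ))

/-- The tight-functional check at assignment `σ`. -/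
def LCert.ok (l m n : ℕ) (K ph : List ℕ) (σ : List (ℕ × ℕ)) (L : LCert) : Bool :=
  let D := L.xs.length * (l * n)
  let G := uList l m n L.xs ++ aVecs l m n L.xs σ
  L.xs.all (memB (l * m) K) &&
  L.gA.all (assigned σ) &&
  (aVecs l m n L.xs σ).all (fun v => (allXors (L.gAv l m n σ)).elem v) &&
  echelonB (L.R l m n σ) && (L.R l m n σ).all (· < 2 ^ D) &&
  L.Y.all (fun y => G.all fun v => !bdot D y v) &&
  L.Y.all (fun y => (L.gAv l m n σ).all fun v => !bdot D y v) &&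
  decide (L.gA.length + unassignedCount l m ph L.xs σ ≤ (L.R l m n σ).length)

/-- The violated-count check: strictly more independent vectors than `dim A + #unassigned`. -/
def LCert.violated (l m n : ℕ) (K ph : List ℕ) (σ : List (ℕ × ℕ)) (L : LCert) : Bool :=
  L.ok l m n K ph σ && decide (L.gA.length + unassignedCount l m ph L.xs σ < (L.R l m n σ).length)

/-- Output value `c` for class `g` is excluded by MEMBERSHIP in `A` at the tight functional `L`. -/
def LCert.aExcludes (l m n : ℕ) (σ : List (ℕ × ℕ)) (L : LCert) (g c : ℕ) : Bool :=
  let lp := lval (l * m) L.xs g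
  (lp != 0) && (allXors (L.gAv l m n σ)).elem (kronBits (l * n) L.xs.length lp c)

/-- The folded annihilator rows of `L` for class `g` (vectors of `𝔽₂^{l n}`). -/
def LCert.rowsFor (l m n : ℕ) (L : LCert) (g : ℕ) : List ℕ :=
  L.Y.map (foldBits (l * n) L.xs.length (lval (l * m) L.xs g))

/-- All folded rows of a node certificate. -/
def NodeCert.rows (l m n : ℕ) (nc : NodeCert) (g : ℕ) : List ℕ :=
  (nc.Ls.map fun L => L.rowsFor l m n g).flatten

/-- The node check: tight functionals pass and meet `g`; duality certificate for the kernel of the rows. -/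
def NodeCert.ok (l m n : ℕ) (K ph : List ℕ) (σ : List (ℕ × ℕ)) (g : ℕ) (nc : NodeCert) : Bool :=
  let w := l * n
  let rows := nc.rows l m n g
  let E := nc.Esel.map (xorSel rows)
  nc.Ls.all (LCert.ok l m n K ph σ) &&
  nc.Ls.all (fun L => lval (l * m) L.xs g != 0) &&
  decide (E.length = nc.X.length) && deltaB w E nc.X &&
  nc.Z.all (· < 2 ^ w) && echelonB nc.Z &&
  nc.Z.all (fun z => rows.all fun r => !bdot w r z) &&
  decide (E.length + nc.Z.length = w)

/-- **The replay check** of a refutation tree at assignment `σ`. -/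
def RNode.check (l m n : ℕ) (K ph : List ℕ) {W : ℕ} : RNode W → List (ℕ × ℕ) → Bool
  | .D g nc, σ => decide (g ∈ ph) && !assigned σ g && nc.ok l m n K ph σ g &&
      (allXors nc.Z).all fun c => decide (c = 0) || nc.Ls.any fun L => L.aExcludes l m n σ g c
  | .V L, σ => L.violated l m n K ph σ
  | .B g nc kids, σ => decide (ph.count g = 1) && !assigned σ g && nc.ok l m n K ph σ g &&
      (allXors nc.Z).all fun c => decide (c = 0) || (nc.Ls.any fun L => L.aExcludes l m n σ g c) ||
        (if h : c < W then (kids ⟨c, h⟩).check l m n K ph (σ ++ [(g, c)]) else false)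
  | .S g wit reps kids, σ => decide (σ = []) && decide (ph.count g = 1) &&
      reps.all (fun r => if h : r < W then (kids ⟨r, h⟩).check l m n K ph [(g, r)] else false) &&
      decide (∀ c : Fin W, c.1 = 0 ∨
        (mulBits l n n c.1 (wit c).1 ∈ reps ∧ mulBits n n n (wit c).1 (wit c).2 = oneBits n ∧
          mulBits n n n (wit c).2 (wit c).1 = oneBits n))
  | .fail, _ => false

/-- Data helper: children from an association list (missing values ↦ `fail`). -/
def kidsOf {W : ℕ} (L : List (ℕ × RNode W)) : Fin W → RNode W := fun c =>
  match L.find? (fun e => e.1 == c.1) with | some e => e.2 | none => .fail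

/-- Data helper: symmetry witnesses from a list indexed by `c − 1`. -/
def witOf {W : ℕ} (L : List (ℕ × ℕ)) : Fin W → ℕ × ℕ := fun c => L.getD (c.1 - 1) (0, 0)

end Summit.Ventures.MM22.GF2Cert.Realize
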